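import Literature.Analysis.FluidPDE.NSBoundedVorticityReduction
import Literature.Analysis.FluidPDE.DistributionalPressurePoisson
import Literature.Analysis.FunctionSpaces.SobolevNormSq
import HarnessLib

/-!
# The weak vorticity equation of a bounded local weak Navier–Stokes solution — proofs

Analysis/FluidPDE proofs file: it **discharges** the named fact
`Literature.Analysis.FluidPDE.NSSpinHeatEquation` (`NSBoundedVorticityReduction.lean`;
Robinson–Rodrigo–Sadowski 2016, Thm. 12.1 with (12.4), in the local form used in the proof of
Thm. 13.7, §13.3.2 Step 1): for a distributional Navier–Stokes solution `(u, p)` (`ν = 1`, no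
force) on a centred parabolic cylinder `Q*_R(z) ⊆ ℝ × ℝ³` with `|u| ≤ M` a.e. and a weak spatial
gradient `G = ∇u ∈ L²(Q*_R(z))`, every entry `A_{bc} = G_{bc} - G_{cb} = ∂_c u_b - ∂_b u_c` of
`∇u - (∇u)ᵀ` satisfies, against every `ψ ∈ C_c^∞(Q*_R(z))`,
`∫∫ A_{bc} (∂ₜψ + Δψ) = ∫∫ ⟪spinFlux u G b c, ∇ψ⟫`,
`spinFlux u G b c = -(Σⱼ uⱼA_{bj}) e_c + (Σⱼ uⱼA_{cj}) e_b` — i.e. `∂ₜA - ΔA = div(flux)` in `𝒟'`,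
componentwise the vorticity equation `∂ₜωᵢ - Δωᵢ = ∂ⱼ(ωⱼuᵢ - uⱼωᵢ)` (`NSSpinHeatEquation_holds`).

## Proof (RRS 2016, proof of Thm. 12.1, pp. 167–168, antisymmetrised; all steps proved here)

1. *Weak gradient.* Testing the weak-gradient identity with `χ = ∂ₜψ + Δψ ∈ C_c^∞(Q)` gives
   `∫∫ A_{bc} χ = -∫∫ (∂_cχ) u_b + ∫∫ (∂_bχ) u_c` (`NSSpinHeat.integral_test_mul_gradE`).
2. *Momentum.* The field `Ψ = -(∂_cψ) e_b + (∂_bψ) e_c ∈ C_c^∞(Q; ℝ³)` is divergence free and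
   `∂ₜΨ + ΔΨ = -(∂_cχ) e_b + (∂_bχ) e_c` (Schwarz: `∂ₜ∂ = ∂∂ₜ`, `Δ∂ = ∂Δ`), so the momentum
   equation tested with `Ψ` reads
   `-∫∫ (∂_cχ) u_b + ∫∫ (∂_bχ) u_c = ∫∫ Σⱼ (∂ⱼ∂_cψ) uⱼu_b - ∫∫ Σⱼ (∂ⱼ∂_bψ) uⱼu_c`
   (`NSSpinHeat.momentum_pairField`; this is RRS's "`curl φ` is divergence free and as a
   consequence can be used as a test function", (12.5)).
3. *Product rule.* For a.e. `t` the slice `u(t, ·)` lies in `W^{1,2}(B) ∩ L^∞` (the tree's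
   `HasWeakSpatialGradientOn.ae_hasWeakFDerivOn_slice`), so `∂ₐ(uᵢuₖ) = uᵢ∂ₐuₖ + uₖ∂ₐuᵢ`
   weakly (polarisation of the tree's chain rule `FunctionSpaces.hasWeakFDerivOn_norm_sq` for
   `|w|²`, `w ∈ W^{1,2}`), and by Fubini
   `∫∫ (∂ₐθ) uᵢuₖ = -∫∫ θ (uᵢG_{ka} + uₖG_{ia})` on the cylinder
   (`NSSpinHeat.integral_fderiv_mul_inner_mul_inner`); with `tr G = 0` a.e.
   (`SerrinBoundedHolder.ae_trace_eq_zero`) the right side of step 2 becomes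
   `-∫∫ (∂_cψ) ΣⱼuⱼG_{bj} + ∫∫ (∂_bψ) ΣⱼuⱼG_{cj}` (RRS's `(u·∇)u` tested against `curl φ`).
4. *Symmetric part.* `G_{bj} = A_{bj} + G_{jb}` and `ΣⱼuⱼG_{jb} = ½∂_b|u|²` weakly (the same
   product rule), so the symmetric contributions are `½∫∫ |u|² (∂_b∂_cψ - ∂_c∂_bψ) = 0`
   (Schwarz) — RRS's `⟨∇|u|², curl φ⟩ = 0` via (12.2).

## Contents

* test-field algebra on a general open `Q`: closure under directional derivatives, sums,
  scalar-times-vector (`NSSpinHeat.isSpaceTimeTestOn_fderiv_apply`, `_add`, `_smul_const`), the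
  fields `pairField θ₁ θ₂ v₁ v₂ = θ₁v₁ + θ₂v₂` with their `∂ₜ`, `D`, `Δ`, `div`, `(u·∇)`
  (`timeDeriv_pairField`, …, `convect_pairField`), the exchanges `∂ₜ∂ᵥψ = ∂ᵥ∂ₜψ`,
  `Δ∂ᵥψ = ∂ᵥΔψ` (`timeDeriv_fderiv_apply`, `laplacian_fderiv_apply`);
* slices of space–time test functions on product regions are test functions
  (`isTestFunctionOn_slice`); weak derivatives under continuous linear maps of the values
  (`hasWeakFDerivOn_clm_apply`); the slice product rule
  (`setIntegral_fderiv_mul_inner_mul_inner`) and its cylinder form;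
* coordinates `velC`, `gradE`, the derived test `heatTest ψ = ∂ₜψ + Δψ`, integrability of test
  functions against the locally integrable data, and the four steps above;
* `NSSpinHeatEquation_holds`.

## Mathlib / tree search

Mathlib (this pin): `ContDiffAt.laplacian_add`, `ContDiffAt.laplacian_CLM_comp_left`,
`fderiv_smul_const`, `deriv_smul_const`, `integral_prod`, `Measure.prod_restrict`,
`IntegrableOn.of_bound`, `Integrable.bdd_mul`; no weak derivatives. Tree:
`FunctionSpaces.hasWeakFDerivOn_norm_sq` (`SobolevNormSq`), `HasWeakFDerivOn.sub`,
`.const_smul`, `HasWeakSpatialGradientOn.ae_hasWeakFDerivOn_slice` (`WeakGradientSlicing`),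
`IsSpaceTimeTestOn.timeDeriv_isSpaceTimeTestOn` / `.laplacian_isSpaceTimeTestOn`,
`fderiv_laplacian_apply`, `integrable_mul_of_locallyIntegrableOn`
(`DistributionalPressurePoisson`, `HelmholtzAnnihilator`, `SuitableWeakPressure`),
`IsSmoothSpaceTimeOn.deriv_fderiv_slice_eq_fderiv_deriv` (`SpaceTimeCalculus`),
`SerrinBoundedHolder.{ae_trace_eq_zero, fderiv_fderiv_apply_comm, integrableOn_test_smul,
gradient_coord, ae_ae_of_ae_restrict_prod}` (`NSBoundedSpatialHolder`).

## References

* J. C. Robinson, J. L. Rodrigo, W. Sadowski, *The Three-Dimensional Navier–Stokes Equations.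
  Classical theory*, CUP 2016: Thm. 12.1 with (12.2), (12.4), (12.5) (pp. 167–168 of the held
  copy); §13.3.2 Step 1, (13.11)–(13.12) (pp. 185–186). [`RobinsonRodrigoSadowskiCUP2016`]
* D. Gilbarg, N. S. Trudinger, *Elliptic Partial Differential Equations of Second Order*,
  Springer 2001, (7.18) (product rule in `W^{1,p}`). [`GilbargTrudinger2001`]
* L. C. Evans, *Partial Differential Equations*, 2nd ed., AMS 2010, §5.2.3 Thm. 1 (iv).
  [`Evans2010`]
-/

noncomputable section

open MeasureTheory Set Function Filter Topology TopologicalSpace Metric InnerProductSpace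
open scoped NNReal ENNReal RealInnerProductSpace Laplacian ContDiff

namespace Literature.Analysis.FluidPDE

namespace NSSpinHeat

variable {E : Type*} [NormedAddCommGroup E] [InnerProductSpace ℝ E] [FiniteDimensional ℝ E]
  [MeasurableSpace E] [BorelSpace E]
variable {F : Type*} [NormedAddCommGroup F] [NormedSpace ℝ F]

/-! ### Space–time test fields: directional derivatives, sums, scalar-times-vector fields -/

omit [MeasurableSpace E] [BorelSpace E] [FiniteDimensional ℝ E] in
/-- The spatial directional derivative of a space–time test function on `Q` is a space–time
test function on `Q` (the `Q = ⊤` case is the tree's `IsSpaceTimeTestOn.fderiv_apply_top`). [folklore] -/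
theorem isSpaceTimeTestOn_fderiv_apply {Q : Opens (ℝ × E)} {ψ : ℝ → E → F}
    (hψ : IsSpaceTimeTestOn Q ψ) (v : E) :
    IsSpaceTimeTestOn Q (fun t x => fderiv ℝ (ψ t) x v) := by
  have h := (hψ.mono le_top).fderiv_apply_top v
  refine ⟨h.contDiff, h.hasCompactSupport, ?_⟩
  refine (closure_minimal (fun z hz => ?_) (isClosed_tsupport _)).trans hψ.tsupport_subset
  obtain ⟨t, x⟩ := z
  by_contra hz'
  exact hz (by simp [IsSpaceTimeTestOn.fderiv_slice_eq_zero_of_notMem hz'])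

omit [MeasurableSpace E] [BorelSpace E] [InnerProductSpace ℝ E] [FiniteDimensional ℝ E] in
/-- Sums of space–time test fields on `Q` are space–time test fields on `Q`. [folklore] -/
theorem isSpaceTimeTestOn_add [NormedSpace ℝ E] {Q : Opens (ℝ × E)} {ψ₁ ψ₂ : ℝ → E → F}
    (h₁ : IsSpaceTimeTestOn Q ψ₁) (h₂ : IsSpaceTimeTestOn Q ψ₂) :
    IsSpaceTimeTestOn Q (fun t x => ψ₁ t x + ψ₂ t x) := by
  have e : uncurry (fun t x => ψ₁ t x + ψ₂ t x) = uncurry ψ₁ + uncurry ψ₂ := rfl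
  refine ⟨?_, ?_, ?_⟩
  · rw [e]; exact h₁.contDiff.add h₂.contDiff
  · rw [e]; exact h₁.hasCompactSupport.add h₂.hasCompactSupport
  · rw [e]
    refine (closure_minimal ?_ ((isClosed_tsupport _).union (isClosed_tsupport _))).trans
      (union_subset h₁.tsupport_subset h₂.tsupport_subset)
    intro z hz
    rw [mem_support, Pi.add_apply] at hz
    by_contra h
    rw [mem_union, not_or] at h
    have h1 : uncurry ψ₁ z = 0 := image_eq_zero_of_notMem_tsupport h.1
    have h2 : uncurry ψ₂ z = 0 := image_eq_zero_of_notMem_tsupport h.2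
    exact hz (by rw [h1, h2, add_zero])

omit [MeasurableSpace E] [BorelSpace E] [InnerProductSpace ℝ E] [FiniteDimensional ℝ E] in
/-- A scalar space–time test function times a constant vector is a space–time test field. [folklore] -/
theorem isSpaceTimeTestOn_smul_const [NormedSpace ℝ E] {Q : Opens (ℝ × E)} {θ : ℝ → E → ℝ}
    (hθ : IsSpaceTimeTestOn Q θ) (v : F) :
    IsSpaceTimeTestOn Q (fun t x => θ t x • v) := by
  have e : uncurry (fun t x => θ t x • v) = fun z => uncurry θ z • v := rfl
  refine ⟨?_, ?_, ?_⟩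
  · rw [e]; exact hθ.contDiff.smul contDiff_const
  · rw [e]; exact hθ.hasCompactSupport.smul_right
  · rw [e]
    exact (tsupport_smul_subset_left (uncurry θ) fun _ => v).trans hθ.tsupport_subset

/-! ### Calculus of the fields `θ₁ • v₁ + θ₂ • v₂` -/

/-- The vector space–time field `θ₁ v₁ + θ₂ v₂` built from two scalar fields and two constant
vectors (the test fields `curl (ψ a)`-type of the weak vorticity equation are of this form). [folklore] -/
def pairField (θ₁ θ₂ : ℝ → E → ℝ) (v₁ v₂ : E) (t : ℝ) (x : E) : E :=
  θ₁ t x • v₁ + θ₂ t x • v₂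

omit [MeasurableSpace E] [BorelSpace E] [FiniteDimensional ℝ E] in
/-- Unfolding `pairField`. [folklore] -/
@[simp] theorem pairField_apply (θ₁ θ₂ : ℝ → E → ℝ) (v₁ v₂ : E) (t : ℝ) (x : E) :
    pairField θ₁ θ₂ v₁ v₂ t x = θ₁ t x • v₁ + θ₂ t x • v₂ := rfl

variable {Q : Opens (ℝ × E)} {θ₁ θ₂ : ℝ → E → ℝ} {v₁ v₂ : E}

omit [MeasurableSpace E] [BorelSpace E] [FiniteDimensional ℝ E] in
/-- `pairField` of test functions is a test field. [folklore] -/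
theorem isSpaceTimeTestOn_pairField (h₁ : IsSpaceTimeTestOn Q θ₁) (h₂ : IsSpaceTimeTestOn Q θ₂)
    (v₁ v₂ : E) : IsSpaceTimeTestOn Q (pairField θ₁ θ₂ v₁ v₂) :=
  isSpaceTimeTestOn_add (isSpaceTimeTestOn_smul_const h₁ v₁) (isSpaceTimeTestOn_smul_const h₂ v₂)

omit [MeasurableSpace E] [BorelSpace E] [FiniteDimensional ℝ E] in
/-- Time derivative of `pairField`: `∂ₜ(θ₁v₁ + θ₂v₂) = (∂ₜθ₁)v₁ + (∂ₜθ₂)v₂`. [folklore] -/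
theorem timeDeriv_pairField (h₁ : IsSpaceTimeTestOn Q θ₁) (h₂ : IsSpaceTimeTestOn Q θ₂)
    (t : ℝ) (x : E) :
    timeDeriv (pairField θ₁ θ₂ v₁ v₂) t x = timeDeriv θ₁ t x • v₁ + timeDeriv θ₂ t x • v₂ := by
  have hd : ∀ {θ : ℝ → E → ℝ}, IsSpaceTimeTestOn Q θ → DifferentiableAt ℝ (fun s => θ s x) t :=
    fun {θ} hθ => ((hθ.contDiff.comp (contDiff_prodMk_left x)).differentiable (by simp)) t
  simp only [timeDeriv, pairField]
  rw [deriv_fun_add ((hd h₁).smul_const v₁) ((hd h₂).smul_const v₂),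
    deriv_smul_const (hd h₁), deriv_smul_const (hd h₂)]

omit [MeasurableSpace E] [BorelSpace E] [FiniteDimensional ℝ E] in
/-- Spatial derivative of a slice of `pairField`:
`D(θ₁v₁ + θ₂v₂)(x) w = (∂_wθ₁) v₁ + (∂_wθ₂) v₂`. [folklore] -/
theorem fderiv_pairField_apply (h₁ : IsSpaceTimeTestOn Q θ₁) (h₂ : IsSpaceTimeTestOn Q θ₂)
    (t : ℝ) (x w : E) :
    fderiv ℝ (pairField θ₁ θ₂ v₁ v₂ t) x w =
      fderiv ℝ (θ₁ t) x w • v₁ + fderiv ℝ (θ₂ t) x w • v₂ := by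
  have hd : ∀ {θ : ℝ → E → ℝ}, IsSpaceTimeTestOn Q θ → DifferentiableAt ℝ (θ t) x :=
    fun {θ} hθ => ((hθ.contDiff_slice t).differentiable (by simp)) x
  have e : pairField θ₁ θ₂ v₁ v₂ t = fun y => θ₁ t y • v₁ + θ₂ t y • v₂ := rfl
  rw [e, fderiv_fun_add ((hd h₁).smul_const v₁) ((hd h₂).smul_const v₂),
    fderiv_smul_const (hd h₁), fderiv_smul_const (hd h₂)]
  simp

omit [MeasurableSpace E] [BorelSpace E] in
/-- Laplacian of a scalar function times a constant vector: `Δ(θ v) = (Δθ) v`. [folklore] -/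
theorem laplacian_smul_const_apply {θ : E → ℝ} (hθ : ContDiff ℝ 2 θ) (v : E) (x : E) :
    Δ (fun y => θ y • v) x = (Δ θ x) • v := by
  set l : ℝ →L[ℝ] E := (ContinuousLinearMap.id ℝ ℝ).smulRight v with hl
  have e : (fun y => θ y • v) = l ∘ θ := by
    funext y
    simp [hl]
  rw [e, hθ.contDiffAt.laplacian_CLM_comp_left]
  simp [hl]

omit [MeasurableSpace E] [BorelSpace E] in
/-- Laplacian of a slice of `pairField`: `Δ(θ₁v₁ + θ₂v₂) = (Δθ₁)v₁ + (Δθ₂)v₂`. [folklore] -/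
theorem laplacian_pairField (h₁ : IsSpaceTimeTestOn Q θ₁) (h₂ : IsSpaceTimeTestOn Q θ₂)
    (t : ℝ) (x : E) :
    Δ (pairField θ₁ θ₂ v₁ v₂ t) x = (Δ (θ₁ t) x) • v₁ + (Δ (θ₂ t) x) • v₂ := by
  have h2 : ∀ {θ : ℝ → E → ℝ}, IsSpaceTimeTestOn Q θ → ContDiff ℝ 2 (θ t) :=
    fun {θ} hθ => contDiff_infty.1 (hθ.contDiff_slice t) 2
  have e : pairField θ₁ θ₂ v₁ v₂ t = (fun y => θ₁ t y • v₁) + fun y => θ₂ t y • v₂ := rfl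
  have c1 : ContDiff ℝ 2 (fun y => θ₁ t y • v₁) := (h2 h₁).smul contDiff_const
  have c2 : ContDiff ℝ 2 (fun y => θ₂ t y • v₂) := (h2 h₂).smul contDiff_const
  rw [e, ContDiffAt.laplacian_add c1.contDiffAt c2.contDiffAt, laplacian_smul_const_apply (h2 h₁),
    laplacian_smul_const_apply (h2 h₂)]

omit [MeasurableSpace E] [BorelSpace E] in
/-- Divergence of a slice of `pairField`: `div(θ₁v₁ + θ₂v₂) = ∂_{v₁}θ₁ + ∂_{v₂}θ₂`. [folklore] -/
theorem divergence_pairField (h₁ : IsSpaceTimeTestOn Q θ₁) (h₂ : IsSpaceTimeTestOn Q θ₂)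
    (t : ℝ) (x : E) :
    VectorCalculus.divergence (pairField θ₁ θ₂ v₁ v₂ t) x =
      fderiv ℝ (θ₁ t) x v₁ + fderiv ℝ (θ₂ t) x v₂ := by
  set b := stdOrthonormalBasis ℝ E
  rw [divergence_eq_sum_inner_fderiv b]
  simp_rw [fderiv_pairField_apply h₁ h₂ t x, inner_add_right, inner_smul_right,
    Finset.sum_add_distrib]
  have key : ∀ (L : E →L[ℝ] ℝ) (v : E), ∑ i, L (b i) * ⟪b i, v⟫ = L v := by
    intro L v
    conv_rhs => rw [← b.sum_repr' v]
    rw [map_sum]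
    refine Finset.sum_congr rfl fun i _ => ?_
    rw [map_smul, smul_eq_mul, mul_comm]
  rw [key, key]

omit [MeasurableSpace E] [BorelSpace E] [FiniteDimensional ℝ E] in
/-- Convective derivative of a slice of `pairField`:
`(u·∇)(θ₁v₁ + θ₂v₂) = (Dθ₁ u) v₁ + (Dθ₂ u) v₂`. [folklore] -/
theorem convect_pairField (h₁ : IsSpaceTimeTestOn Q θ₁) (h₂ : IsSpaceTimeTestOn Q θ₂)
    (w : E → E) (t : ℝ) (x : E) :
    convect w (pairField θ₁ θ₂ v₁ v₂ t) x =
      fderiv ℝ (θ₁ t) x (w x) • v₁ + fderiv ℝ (θ₂ t) x (w x) • v₂ := by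
  rw [convect_apply, fderiv_pairField_apply h₁ h₂]

/-! ### Exchange of derivatives on test functions -/

omit [MeasurableSpace E] [BorelSpace E] [FiniteDimensional ℝ E] in
/-- `∂ₜ∂ᵥψ = ∂ᵥ∂ₜψ` for a space–time test function (Schwarz, the tree's
`IsSmoothSpaceTimeOn.deriv_fderiv_slice_eq_fderiv_deriv`). [folklore] -/
theorem timeDeriv_fderiv_apply {ψ : ℝ → E → ℝ} (hψ : IsSpaceTimeTestOn Q ψ) (v : E) (t : ℝ)
    (x : E) :
    timeDeriv (fun s y => fderiv ℝ (ψ s) y v) t x = fderiv ℝ (timeDeriv ψ t) x v := by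
  have h := (hψ.isSmoothSpaceTimeOn univ).deriv_fderiv_slice_eq_fderiv_deriv isOpen_univ
    (mem_univ t) x v
  have e : timeDeriv ψ t = fun y => deriv (fun s => ψ s y) t := funext fun y => rfl
  rw [e]
  exact h

omit [MeasurableSpace E] [BorelSpace E] in
/-- `Δ∂ᵥψ = ∂ᵥΔψ` slice-wise for a space–time test function (Schwarz twice, the tree's
`fderiv_laplacian_apply`). [folklore] -/
theorem laplacian_fderiv_apply {ψ : ℝ → E → ℝ} (hψ : IsSpaceTimeTestOn Q ψ) (v : E) (t : ℝ)
    (x : E) :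
    Δ (fun y => fderiv ℝ (ψ t) y v) x = fderiv ℝ (Δ (ψ t)) x v := by
  have h3 : ContDiff ℝ 3 (ψ t) := contDiff_infty.1 (hψ.contDiff_slice t) 3
  rw [fderiv_laplacian_apply h3]

omit [MeasurableSpace E] [BorelSpace E] in
/-- The derivative of the derived test function `∂ₜψ + Δψ` in direction `v` is
`∂ₜ(∂ᵥψ) + Δ(∂ᵥψ)`. [folklore] -/
theorem fderiv_timeDeriv_add_laplacian {ψ : ℝ → E → ℝ} (hψ : IsSpaceTimeTestOn Q ψ) (v : E)
    (t : ℝ) (x : E) :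
    fderiv ℝ (fun y => timeDeriv ψ t y + Δ (ψ t) y) x v =
      timeDeriv (fun s y => fderiv ℝ (ψ s) y v) t x + Δ (fun y => fderiv ℝ (ψ t) y v) x := by
  have hd1 : DifferentiableAt ℝ (timeDeriv ψ t) x :=
    ((hψ.timeDeriv_isSpaceTimeTestOn.contDiff_slice t).differentiable (by simp)) x
  have hd2 : DifferentiableAt ℝ (Δ (ψ t)) x :=
    ((hψ.laplacian_isSpaceTimeTestOn.contDiff_slice t).differentiable (by simp)) x
  rw [fderiv_fun_add hd1 hd2, _root_.add_apply, timeDeriv_fderiv_apply hψ,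
    laplacian_fderiv_apply hψ]

/-! ### Slices of space–time test functions on product regions -/

omit [MeasurableSpace E] [BorelSpace E] [InnerProductSpace ℝ E] [FiniteDimensional ℝ E] in
/-- The time slices of a space–time test function on a product region `I × U` are test
functions on `U` (smooth; supported in the second projection of the support). [folklore] -/
theorem isTestFunctionOn_slice [NormedSpace ℝ E] {I : Set ℝ} {U : Opens E}
    {hO : IsOpen (I ×ˢ (U : Set E))} {θ : ℝ → E → F}
    (hθ : IsSpaceTimeTestOn (⟨I ×ˢ (U : Set E), hO⟩ : Opens (ℝ × E)) θ) (t : ℝ) :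
    FunctionSpaces.IsTestFunctionOn U (θ t) := by
  -- the support of the slice sits inside the preimage of the space–time support
  have hsub : tsupport (θ t) ⊆ (fun x => (t, x)) ⁻¹' tsupport (uncurry θ) := by
    refine closure_minimal (fun x hx => ?_)
      ((isClosed_tsupport _).preimage (continuous_const.prodMk continuous_id))
    exact subset_tsupport _ (by simpa using hx)
  refine ⟨hθ.contDiff_slice t, ?_, ?_⟩
  · refine HasCompactSupport.intro' ((hθ.hasCompactSupport.image continuous_snd).of_isClosed_subset
      (isClosed_tsupport _) ?_) (isClosed_tsupport _) fun x hx => image_eq_zero_of_notMem_tsupport hx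
    intro x hx
    exact ⟨(t, x), hsub hx, rfl⟩
  · intro x hx
    have h := hθ.tsupport_subset (hsub hx)
    simp only [Opens.coe_mk, mem_prod] at h
    exact h.2

/-! ### The weak product rule on a slice -/

/-- Local notation for physical space `ℝ³ = EuclideanSpace ℝ (Fin 3)`. -/
local notation "ℝ³" => EuclideanSpace ℝ (Fin 3)

/-- Weak derivatives are preserved by continuous linear maps of the values:
`D(L ∘ v) = L ∘ Dv` weakly (apply `L` through both integrals; Evans, *PDE*, §5.2.1). [folklore] -/
theorem hasWeakFDerivOn_clm_apply {F' : Type*} [NormedAddCommGroup F'] [NormedSpace ℝ F']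
    [CompleteSpace F'] (L : ℝ³ →L[ℝ] F') {U : Opens ℝ³} {v : ℝ³ → ℝ³} {g : ℝ³ → ℝ³ →L[ℝ] ℝ³}
    (hv : FunctionSpaces.HasWeakFDerivOn U volume v g) :
    FunctionSpaces.HasWeakFDerivOn U volume (fun x => L (v x)) fun x => L.comp (g x) where
  locallyIntegrableOn := L.locallyIntegrableOn_comp hv.locallyIntegrableOn
  locallyIntegrableOn_deriv :=
    ((ContinuousLinearMap.compL ℝ ℝ³ ℝ³ F') L).locallyIntegrableOn_comp hv.locallyIntegrableOn_deriv
  integral_fderiv_smul_eq φ a hφ := by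
    have hid := hv.integral_fderiv_smul_eq φ a hφ
    have hI1 : IntegrableOn (fun x => fderiv ℝ φ x a • v x) (U : Set ℝ³) volume :=
      SerrinBoundedHolder.integrableOn_test_smul (U := U)
        ((hφ.contDiff.continuous_fderiv (by simp)).clm_apply continuous_const)
        (hφ.hasCompactSupport.fderiv_apply (𝕜 := ℝ) a)
        ((tsupport_fderiv_apply_subset ℝ a).trans hφ.tsupport_subset) hv.locallyIntegrableOn
    have hI2 : IntegrableOn (fun x => φ x • g x a) (U : Set ℝ³) volume :=
      SerrinBoundedHolder.integrableOn_test_smul (U := U) hφ.contDiff.continuous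
        hφ.hasCompactSupport hφ.tsupport_subset
        ((ContinuousLinearMap.apply ℝ ℝ³ a).locallyIntegrableOn_comp hv.locallyIntegrableOn_deriv)
    have e1 : (fun x => fderiv ℝ φ x a • L (v x)) = fun x => L (fderiv ℝ φ x a • v x) := by
      funext x; rw [map_smul]
    have e2 : (fun x => φ x • (L.comp (g x)) a) = fun x => L (φ x • g x a) := by
      funext x; rw [map_smul]; rfl
    rw [e1, e2, L.integral_comp_comm hI1, L.integral_comp_comm hI2, ← map_neg, hid]

/-- **The weak product rule for `W^{1,2}` components on a slice.** If `v ∈ L²(U; ℝ³)` has a weak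
derivative `g ∈ L²(U)` on the open set `U ⊆ ℝ³`, then for all constant vectors `e₁, e₂`,
directions `a` and test functions `φ ∈ C_c^∞(U)`,
`∫_U ∂ₐφ ⟪e₁,v⟫⟪e₂,v⟫ = -∫_U φ (⟪e₁,v⟫⟪e₂,∂ₐv⟫ + ⟪e₂,v⟫⟪e₁,∂ₐv⟫)`, i.e.
`∂ₐ(v₁v₂) = v₁∂ₐv₂ + v₂∂ₐv₁` weakly (Gilbarg–Trudinger (7.18); Evans §5.2.3 Thm. 1 (iv); here by
polarisation `4v₁v₂ = (v₁ + v₂)² - (v₁ - v₂)²` of the tree's chain rule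
`FunctionSpaces.hasWeakFDerivOn_norm_sq` for `|w|²`, `w ∈ W^{1,2}`). [folklore] -/
theorem setIntegral_fderiv_mul_inner_mul_inner {U : Opens ℝ³} {v : ℝ³ → ℝ³}
    {g : ℝ³ → ℝ³ →L[ℝ] ℝ³} (hv : FunctionSpaces.HasWeakFDerivOn U volume v g)
    (hv2 : MemLp v 2 (volume.restrict (U : Set ℝ³)))
    (hg2 : MemLp g 2 (volume.restrict (U : Set ℝ³))) {φ : ℝ³ → ℝ}
    (hφ : FunctionSpaces.IsTestFunctionOn U φ) (a e₁ e₂ : ℝ³) :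
    ∫ x in (U : Set ℝ³), fderiv ℝ φ x a * (⟪e₁, v x⟫ * ⟪e₂, v x⟫) =
      -∫ x in (U : Set ℝ³), φ x * (⟪e₁, v x⟫ * ⟪e₂, g x a⟫ + ⟪e₂, v x⟫ * ⟪e₁, g x a⟫) := by
  -- the scalar components `⟪e, v⟫` and their weak derivatives
  set f : ℝ³ → ℝ³ → ℝ := fun e x => innerSL ℝ e (v x) with hf
  set G : ℝ³ → ℝ³ → ℝ³ →L[ℝ] ℝ := fun e x => (innerSL ℝ e).comp (g x) with hG
  have hfe : ∀ e, FunctionSpaces.HasWeakFDerivOn U volume (f e) (G e) := fun e =>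
    hasWeakFDerivOn_clm_apply (innerSL ℝ e) hv
  have hfe2 : ∀ e, MemLp (f e) 2 (volume.restrict (U : Set ℝ³)) := fun e =>
    (innerSL ℝ e).comp_memLp' hv2
  have hGe2 : ∀ e w, MemLp (fun x => G e x w) 2 (volume.restrict (U : Set ℝ³)) := by
    intro e w
    have h1 : MemLp (fun x => g x w) 2 (volume.restrict (U : Set ℝ³)) :=
      (ContinuousLinearMap.apply ℝ ℝ³ w).comp_memLp' hg2
    exact (innerSL ℝ e).comp_memLp' h1
  have Hq : ∀ e, FunctionSpaces.HasWeakFDerivOn U volume (fun x => ‖f e x‖ ^ 2)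
      (fun x => (2 : ℝ) • (innerSL ℝ (f e x)).comp (G e x)) := fun e =>
    FunctionSpaces.hasWeakFDerivOn_norm_sq (hfe2 e) (hfe e) (hGe2 e)
  -- polarisation
  have hpol := ((Hq (e₁ + e₂)).sub (Hq (e₁ - e₂))).const_smul (1 / 4 : ℝ)
  have key := hpol.integral_fderiv_smul_eq φ a hφ
  have hL : (fun x => fderiv ℝ φ x a •
      ((1 / 4 : ℝ) • ((fun x => ‖f (e₁ + e₂) x‖ ^ 2) - fun x => ‖f (e₁ - e₂) x‖ ^ 2)) x) =
      fun x => fderiv ℝ φ x a * (⟪e₁, v x⟫ * ⟪e₂, v x⟫) := by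
    funext x
    simp only [hf, Pi.smul_apply, Pi.sub_apply, smul_eq_mul, innerSL_apply_apply, Real.norm_eq_abs,
      sq_abs, inner_add_left, inner_sub_left]
    ring
  have hR : (fun x => φ x • ((1 / 4 : ℝ) •
      ((fun x => (2 : ℝ) • (innerSL ℝ (f (e₁ + e₂) x)).comp (G (e₁ + e₂) x)) -
        fun x => (2 : ℝ) • (innerSL ℝ (f (e₁ - e₂) x)).comp (G (e₁ - e₂) x))) x a) =
      fun x => φ x * (⟪e₁, v x⟫ * ⟪e₂, g x a⟫ + ⟪e₂, v x⟫ * ⟪e₁, g x a⟫) := by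
    funext x
    simp only [hf, hG, Pi.smul_apply, Pi.sub_apply, smul_eq_mul, FunLike.coe_smul,
      FunLike.coe_sub, ContinuousLinearMap.coe_comp, comp_apply, innerSL_apply_apply,
      Real.inner_apply, inner_add_left, inner_sub_left]
    ring
  rw [hL, hR] at key
  exact key

/-! ### The weak product rule on a cylinder -/

/-- A centred parabolic cylinder has finite measure. [folklore] -/
theorem volume_parabolicCylinderCentered_lt_top (R : ℝ) (z : ℝ × ℝ³) :
    volume (parabolicCylinderCentered R z) < ⊤ := by
  have hsub : parabolicCylinderCentered R z ⊆ Icc (z.1 - R ^ 2) (z.1 + R ^ 2) ×ˢ closedBall z.2 R :=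
    prod_mono Ioo_subset_Icc_self ball_subset_closedBall
  exact (measure_mono hsub).trans_lt
    ((isCompact_Icc.prod (isCompact_closedBall _ _)).measure_lt_top)

/-- An integral over space–time of a function vanishing off the cylinder `I × B` is the iterated
integral `∫_I ∫_B` (Fubini). [folklore] -/
theorem integral_eq_iterated_of_eq_zero_off {I : Set ℝ} {B : Set ℝ³} {f : ℝ × ℝ³ → ℝ}
    (hf : Integrable f (volume : Measure (ℝ × ℝ³))) (h0 : ∀ q, q ∉ I ×ˢ B → f q = 0) :
    ∫ q, f q = ∫ t in I, ∫ x in B, f (t, x) := by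
  rw [← setIntegral_eq_integral_of_forall_compl_eq_zero h0]
  have hf' : Integrable f ((volume.restrict I).prod (volume.restrict B)) := by
    rw [Measure.prod_restrict, ← Measure.volume_eq_prod]
    exact hf.integrableOn
  rw [Measure.volume_eq_prod, ← Measure.prod_restrict, integral_prod _ hf']

/-- A bounded measurable function times a function locally integrable on `S` is locally
integrable on `S`. [folklore] -/
theorem locallyIntegrableOn_bdd_mul {S : Set (ℝ × ℝ³)} {f g : ℝ × ℝ³ → ℝ} {C : ℝ}
    (hg : LocallyIntegrableOn g S volume) (hf : AEStronglyMeasurable f (volume.restrict S))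
    (hfC : ∀ᵐ q ∂(volume.restrict S), ‖f q‖ ≤ C) :
    LocallyIntegrableOn (fun q => f q * g q) S volume := by
  intro q hq
  obtain ⟨V, hV, hgV⟩ := hg q hq
  refine ⟨V ∩ S, inter_mem hV self_mem_nhdsWithin, ?_⟩
  have hgV' : IntegrableOn g (V ∩ S) volume := hgV.mono_set inter_subset_left
  have hle : volume.restrict (V ∩ S) ≤ volume.restrict S := Measure.restrict_mono inter_subset_right le_rfl
  exact Integrable.bdd_mul hgV' (hf.mono_measure hle) (ae_mono hle hfC)

variable {u : ℝ → ℝ³ → ℝ³} {G : ℝ → ℝ³ → ℝ³ →L[ℝ] ℝ³} {z : ℝ × ℝ³} {R M : ℝ}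

/-- Local integrability on the cylinder of the products `⟪e₁, u⟫ ⟪e₂, u⟫` of components of a
bounded field. [folklore] -/
theorem locallyIntegrableOn_inner_mul_inner
    (hu : LocallyIntegrableOn (uncurry u) (parabolicCylinderCentered R z) volume)
    (hbd : ∀ᵐ q ∂(volume.restrict (parabolicCylinderCentered R z)), ‖u q.1 q.2‖ ≤ M)
    (e₁ e₂ : ℝ³) :
    LocallyIntegrableOn (fun q : ℝ × ℝ³ => ⟪e₁, u q.1 q.2⟫ * ⟪e₂, u q.1 q.2⟫)
      (parabolicCylinderCentered R z) volume := by
  have hum : AEStronglyMeasurable (uncurry u) (volume.restrict (parabolicCylinderCentered R z)) :=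
    hu.aestronglyMeasurable
  have hm : AEStronglyMeasurable (fun q : ℝ × ℝ³ => ⟪e₁, u q.1 q.2⟫ * ⟪e₂, u q.1 q.2⟫)
      (volume.restrict (parabolicCylinderCentered R z)) :=
    (aestronglyMeasurable_const.inner hum).mul (aestronglyMeasurable_const.inner hum)
  refine (IntegrableOn.of_bound (volume_parabolicCylinderCentered_lt_top R z) hm
    (‖e₁‖ * |M| * (‖e₂‖ * |M|)) ?_).locallyIntegrableOn
  filter_upwards [hbd] with q hq
  rw [norm_mul]
  have h1 : ∀ e : ℝ³, ‖⟪e, u q.1 q.2⟫‖ ≤ ‖e‖ * |M| := fun e =>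
    (norm_inner_le_norm _ _).trans (mul_le_mul_of_nonneg_left (hq.trans (le_abs_self M))
      (norm_nonneg _))
  exact mul_le_mul (h1 e₁) (h1 e₂) (norm_nonneg _) (by positivity)

/-- Local integrability on the cylinder of `⟪e₁, u⟫ ⟪e₂, G a⟫` for a bounded field `u` and a
locally integrable `G`. [folklore] -/
theorem locallyIntegrableOn_inner_mul_inner_grad
    (hu : LocallyIntegrableOn (uncurry u) (parabolicCylinderCentered R z) volume)
    (hbd : ∀ᵐ q ∂(volume.restrict (parabolicCylinderCentered R z)), ‖u q.1 q.2‖ ≤ M)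
    (hGl : LocallyIntegrableOn (uncurry G) (parabolicCylinderCentered R z) volume)
    (e₁ e₂ a : ℝ³) :
    LocallyIntegrableOn (fun q : ℝ × ℝ³ => ⟪e₁, u q.1 q.2⟫ * ⟪e₂, G q.1 q.2 a⟫)
      (parabolicCylinderCentered R z) volume := by
  have hum : AEStronglyMeasurable (uncurry u) (volume.restrict (parabolicCylinderCentered R z)) :=
    hu.aestronglyMeasurable
  have hGa : LocallyIntegrableOn (fun q : ℝ × ℝ³ => ⟪e₂, G q.1 q.2 a⟫)
      (parabolicCylinderCentered R z) volume :=
    ((innerSL ℝ e₂).comp (ContinuousLinearMap.apply ℝ ℝ³ a)).locallyIntegrableOn_comp hGl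
  refine locallyIntegrableOn_bdd_mul hGa (aestronglyMeasurable_const.inner hum) (C := ‖e₁‖ * |M|) ?_
  filter_upwards [hbd] with q hq
  exact (norm_inner_le_norm _ _).trans
    (mul_le_mul_of_nonneg_left (hq.trans (le_abs_self M)) (norm_nonneg _))

/-- Integrability over space–time of a test function times a function locally integrable on
the cylinder. [folklore] -/
theorem integrable_test_mul {f : ℝ × ℝ³ → ℝ}
    (hf : LocallyIntegrableOn f (parabolicCylinderCentered R z) volume) {θ : ℝ → ℝ³ → ℝ}
    (hθ : IsSpaceTimeTestOn (parabolicCylinderCenteredOpens R z) θ) :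
    Integrable (fun q : ℝ × ℝ³ => θ q.1 q.2 * f q) (volume : Measure (ℝ × ℝ³)) := by
  have h := integrable_mul_of_locallyIntegrableOn (Q := parabolicCylinderCenteredOpens R z) hf
    (w := uncurry θ) hθ.contDiff.continuous hθ.hasCompactSupport hθ.tsupport_subset
    (fun q hq => image_eq_zero_of_notMem_tsupport hq)
  refine h.congr (Eventually.of_forall fun q => ?_)
  simp only [uncurry, mul_comm]

/-- **The weak product rule on a cylinder.** For a bounded field `u` with a weak spatial gradient
`G ∈ L²` on `Q*_R(z)`, the products of components satisfy, against every space–time test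
function `θ ∈ C_c^∞(Q*_R(z))`,
`∫∫ ∂ₐθ ⟪e₁,u⟫⟪e₂,u⟫ = -∫∫ θ (⟪e₁,u⟫⟪e₂,∂ₐu⟫ + ⟪e₂,u⟫⟪e₁,∂ₐu⟫)`
(slice-wise: for a.e. `t`, `u(t, ·) ∈ W^{1,2}(B)` by the tree's slicing theorem, the slice rule
`setIntegral_fderiv_mul_inner_mul_inner`, and Fubini). [folklore] -/
theorem integral_fderiv_mul_inner_mul_inner
    (hbd : ∀ᵐ q ∂(volume.restrict (parabolicCylinderCentered R z)), ‖u q.1 q.2‖ ≤ M)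
    (hG : HasWeakSpatialGradientOn (parabolicCylinderCenteredOpens R z) u G)
    (hG2 : ∫⁻ q in parabolicCylinderCentered R z, ENNReal.ofReal (frobeniusNormSq (G q.1 q.2)) < ⊤)
    {θ : ℝ → ℝ³ → ℝ} (hθ : IsSpaceTimeTestOn (parabolicCylinderCenteredOpens R z) θ)
    (a e₁ e₂ : ℝ³) :
    ∫ q : ℝ × ℝ³, fderiv ℝ (θ q.1) q.2 a * (⟪e₁, u q.1 q.2⟫ * ⟪e₂, u q.1 q.2⟫) =
      -∫ q : ℝ × ℝ³, θ q.1 q.2 *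
        (⟪e₁, u q.1 q.2⟫ * ⟪e₂, G q.1 q.2 a⟫ + ⟪e₂, u q.1 q.2⟫ * ⟪e₁, G q.1 q.2 a⟫) := by
  set I : Set ℝ := Ioo (z.1 - R ^ 2) (z.1 + R ^ 2) with hI
  set U : Opens ℝ³ := ⟨ball z.2 R, isOpen_ball⟩ with hU
  -- the cylinder as a product region
  have hle : (⟨I ×ˢ (U : Set ℝ³), isOpen_Ioo.prod U.isOpen⟩ : Opens (ℝ × ℝ³)) ≤
      parabolicCylinderCenteredOpens R z := fun q hq => hq
  have hge : parabolicCylinderCenteredOpens R z ≤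
      (⟨I ×ˢ (U : Set ℝ³), isOpen_Ioo.prod U.isOpen⟩ : Opens (ℝ × ℝ³)) := fun q hq => hq
  have hGρ : HasWeakSpatialGradientOn
      (⟨I ×ˢ (U : Set ℝ³), isOpen_Ioo.prod U.isOpen⟩ : Opens (ℝ × ℝ³)) u G := hG.mono hle
  have hθ' : IsSpaceTimeTestOn (⟨I ×ˢ (U : Set ℝ³), isOpen_Ioo.prod U.isOpen⟩ : Opens (ℝ × ℝ³)) θ :=
    hθ.mono hge
  have hu : LocallyIntegrableOn (uncurry u) (parabolicCylinderCentered R z) volume :=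
    hG.locallyIntegrableOn
  have hGl : LocallyIntegrableOn (uncurry G) (parabolicCylinderCentered R z) volume :=
    hG.locallyIntegrableOn_grad
  -- slices: weak gradient, bound, energy
  have hS1 : ∀ᵐ t ∂(volume.restrict I), FunctionSpaces.HasWeakFDerivOn U volume (u t) (G t) :=
    hGρ.ae_hasWeakFDerivOn_slice
  have hS2 : ∀ᵐ t ∂(volume.restrict I), ∀ᵐ x ∂(volume.restrict (ball z.2 R)), ‖u t x‖ ≤ M :=
    SerrinBoundedHolder.ae_ae_of_ae_restrict_prod (P := fun w => ‖u w.1 w.2‖ ≤ M) hbd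
  have hGm : AEStronglyMeasurable (uncurry G) (volume.restrict (parabolicCylinderCentered R z)) :=
    hGl.aestronglyMeasurable
  have hS4 : ∀ᵐ t ∂(volume.restrict I), ∫⁻ x in ball z.2 R, ‖G t x‖ₑ ^ (2 : ℝ) < ⊤ := by
    refine SerrinBoundedHolder.ae_lintegral_lt_top_of_lintegral_prod
      (f := fun w => ‖G w.1 w.2‖ₑ ^ (2 : ℝ)) (hGm.aemeasurable.enorm.pow_const _) ?_
    calc ∫⁻ w in I ×ˢ ball z.2 R, ‖G w.1 w.2‖ₑ ^ (2 : ℝ)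
        ≤ ∫⁻ w in parabolicCylinderCentered R z, ENNReal.ofReal (frobeniusNormSq (G w.1 w.2)) :=
          lintegral_mono fun w => SerrinBoundedHolder.enorm_rpow_two_le_ofReal_frobeniusNormSq _
      _ < ⊤ := hG2
  -- the slice identity for a.e. `t`
  have hslice : ∀ᵐ t ∂(volume.restrict I),
      ∫ x in ball z.2 R, fderiv ℝ (θ t) x a * (⟪e₁, u t x⟫ * ⟪e₂, u t x⟫) =
        -∫ x in ball z.2 R, θ t x * (⟪e₁, u t x⟫ * ⟪e₂, G t x a⟫ + ⟪e₂, u t x⟫ * ⟪e₁, G t x a⟫) := by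
    filter_upwards [hS1, hS2, hS4] with t h1 h2 h4
    haveI : IsFiniteMeasure (volume.restrict (ball z.2 R)) :=
      isFiniteMeasure_restrict.2 measure_ball_lt_top.ne
    have hv2 : MemLp (u t) 2 (volume.restrict (ball z.2 R)) :=
      MemLp.of_bound h1.locallyIntegrableOn.aestronglyMeasurable M h2
    have hg2 : MemLp (G t) 2 (volume.restrict (ball z.2 R)) := by
      refine ⟨h1.locallyIntegrableOn_deriv.aestronglyMeasurable, ?_⟩
      rw [eLpNorm_eq_lintegral_rpow_enorm_toReal two_ne_zero ENNReal.ofNat_ne_top,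
        ENNReal.toReal_ofNat]
      exact ENNReal.rpow_lt_top_of_nonneg (by norm_num) h4.ne
    exact setIntegral_fderiv_mul_inner_mul_inner h1 hv2 hg2 (isTestFunctionOn_slice hθ' t) a e₁ e₂
  -- integrability of both space–time integrands
  have hdθ := isSpaceTimeTestOn_fderiv_apply hθ a
  have IL : Integrable (fun q : ℝ × ℝ³ =>
      fderiv ℝ (θ q.1) q.2 a * (⟪e₁, u q.1 q.2⟫ * ⟪e₂, u q.1 q.2⟫)) (volume : Measure (ℝ × ℝ³)) :=
    integrable_test_mul (locallyIntegrableOn_inner_mul_inner hu hbd e₁ e₂) hdθ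
  have IR : Integrable (fun q : ℝ × ℝ³ => θ q.1 q.2 *
      (⟪e₁, u q.1 q.2⟫ * ⟪e₂, G q.1 q.2 a⟫ + ⟪e₂, u q.1 q.2⟫ * ⟪e₁, G q.1 q.2 a⟫))
      (volume : Measure (ℝ × ℝ³)) :=
    integrable_test_mul ((locallyIntegrableOn_inner_mul_inner_grad hu hbd hGl e₁ e₂ a).add
      (locallyIntegrableOn_inner_mul_inner_grad hu hbd hGl e₂ e₁ a)) hθ
  -- both integrands vanish off the cylinder
  have h0L : ∀ q : ℝ × ℝ³, q ∉ I ×ˢ ball z.2 R →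
      fderiv ℝ (θ q.1) q.2 a * (⟪e₁, u q.1 q.2⟫ * ⟪e₂, u q.1 q.2⟫) = 0 := by
    intro q hq
    have hq' : q ∉ tsupport (uncurry fun t x => fderiv ℝ (θ t) x a) := fun h => hq (hdθ.tsupport_subset h)
    have h0 := image_eq_zero_of_notMem_tsupport hq'
    have : fderiv ℝ (θ q.1) q.2 a = 0 := h0
    rw [this, zero_mul]
  have h0R : ∀ q : ℝ × ℝ³, q ∉ I ×ˢ ball z.2 R → θ q.1 q.2 *
      (⟪e₁, u q.1 q.2⟫ * ⟪e₂, G q.1 q.2 a⟫ + ⟪e₂, u q.1 q.2⟫ * ⟪e₁, G q.1 q.2 a⟫) = 0 := by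
    intro q hq
    have hq' : q ∉ tsupport (uncurry θ) := fun h => hq (hθ.tsupport_subset h)
    have h0 := image_eq_zero_of_notMem_tsupport hq'
    have : θ q.1 q.2 = 0 := h0
    rw [this, zero_mul]
  rw [integral_eq_iterated_of_eq_zero_off IL h0L, integral_eq_iterated_of_eq_zero_off IR h0R,
    ← integral_neg]
  refine integral_congr_ae ?_
  filter_upwards [hslice] with t ht
  exact ht

/-! ### Coordinates: velocity components, gradient entries, the derived test `∂ₜψ + Δψ` -/

/-- Local notation for the standard basis vectors of `ℝ³`. -/
local notation "𝐞" j => EuclideanSpace.single (j : Fin 3) (1 : ℝ)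

/-- The components of the velocity as functions on space–time: `velC u i (t, x) = uᵢ(t, x)`. [folklore] -/
def velC (u : ℝ → ℝ³ → ℝ³) (i : Fin 3) (q : ℝ × ℝ³) : ℝ := u q.1 q.2 i

/-- The entries of the (weak) gradient as functions on space–time:
`gradE G i j (t, x) = Gᵢⱼ = (G eⱼ)ᵢ = ∂ⱼuᵢ`. [folklore] -/
def gradE (G : ℝ → ℝ³ → ℝ³ →L[ℝ] ℝ³) (i j : Fin 3) (q : ℝ × ℝ³) : ℝ := G q.1 q.2 (𝐞 j) i

/-- The derived test function `∂ₜψ + Δψ` (the adjoint heat operator applied to `ψ`). [folklore] -/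
def heatTest (ψ : ℝ → ℝ³ → ℝ) (t : ℝ) (x : ℝ³) : ℝ := timeDeriv ψ t x + Δ (ψ t) x

/-- Unfolding `velC`. [folklore] -/
@[simp] theorem velC_apply (u : ℝ → ℝ³ → ℝ³) (i : Fin 3) (q : ℝ × ℝ³) : velC u i q = u q.1 q.2 i := rfl

/-- Unfolding `gradE`. [folklore] -/
@[simp] theorem gradE_apply (G : ℝ → ℝ³ → ℝ³ →L[ℝ] ℝ³) (i j : Fin 3) (q : ℝ × ℝ³) :
    gradE G i j q = G q.1 q.2 (𝐞 j) i := rfl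

/-- Unfolding `heatTest`. [folklore] -/
@[simp] theorem heatTest_apply (ψ : ℝ → ℝ³ → ℝ) (t : ℝ) (x : ℝ³) :
    heatTest ψ t x = timeDeriv ψ t x + Δ (ψ t) x := rfl

/-- `⟪eᵢ, y⟫ = yᵢ`. [folklore] -/
@[simp] theorem inner_single_left_one (i : Fin 3) (y : ℝ³) : ⟪𝐞 i, y⟫ = y i := by
  simp [EuclideanSpace.inner_single_left]

/-- `⟪y, eᵢ⟫ = yᵢ`. [folklore] -/
@[simp] theorem inner_single_right_one (i : Fin 3) (y : ℝ³) : ⟪y, 𝐞 i⟫ = y i := by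
  simp [EuclideanSpace.inner_single_right]

/-- A linear functional in coordinates: `L y = Σⱼ yⱼ L(eⱼ)`. [folklore] -/
theorem clm_apply_eq_sum (L : ℝ³ →L[ℝ] ℝ) (y : ℝ³) : L y = ∑ j, y j * L (𝐞 j) := by
  conv_lhs => rw [SerrinBoundedHolder.eq_sum_coord_smul_single y]
  simp [map_sum, map_smul]

/-- `∂ₜψ + Δψ` is a space–time test function on `Q` when `ψ` is. [folklore] -/
theorem isSpaceTimeTestOn_heatTest {Q : Opens (ℝ × ℝ³)} {ψ : ℝ → ℝ³ → ℝ}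
    (hψ : IsSpaceTimeTestOn Q ψ) : IsSpaceTimeTestOn Q (heatTest ψ) :=
  isSpaceTimeTestOn_add hψ.timeDeriv_isSpaceTimeTestOn hψ.laplacian_isSpaceTimeTestOn

variable {p : ℝ → ℝ³ → ℝ}

/-- The velocity components are locally integrable on the cylinder. [folklore] -/
theorem locallyIntegrableOn_velC
    (hu : LocallyIntegrableOn (uncurry u) (parabolicCylinderCentered R z) volume) (i : Fin 3) :
    LocallyIntegrableOn (velC u i) (parabolicCylinderCentered R z) volume :=
  (EuclideanSpace.proj i : ℝ³ →L[ℝ] ℝ).locallyIntegrableOn_comp hu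

/-- The gradient entries are locally integrable on the cylinder. [folklore] -/
theorem locallyIntegrableOn_gradE
    (hGl : LocallyIntegrableOn (uncurry G) (parabolicCylinderCentered R z) volume) (i j : Fin 3) :
    LocallyIntegrableOn (gradE G i j) (parabolicCylinderCentered R z) volume :=
  ((EuclideanSpace.proj i : ℝ³ →L[ℝ] ℝ).comp (ContinuousLinearMap.apply ℝ ℝ³ (𝐞 j))).locallyIntegrableOn_comp hGl

/-- Products of velocity components are locally integrable on the cylinder. [folklore] -/
theorem locallyIntegrableOn_velC_mul_velC
    (hu : LocallyIntegrableOn (uncurry u) (parabolicCylinderCentered R z) volume)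
    (hbd : ∀ᵐ q ∂(volume.restrict (parabolicCylinderCentered R z)), ‖u q.1 q.2‖ ≤ M)
    (i k : Fin 3) :
    LocallyIntegrableOn (fun q => velC u i q * velC u k q) (parabolicCylinderCentered R z) volume := by
  have h := locallyIntegrableOn_inner_mul_inner hu hbd (𝐞 i) (𝐞 k)
  simpa using h

/-- Velocity components times gradient entries are locally integrable on the cylinder. [folklore] -/
theorem locallyIntegrableOn_velC_mul_gradE
    (hu : LocallyIntegrableOn (uncurry u) (parabolicCylinderCentered R z) volume)
    (hbd : ∀ᵐ q ∂(volume.restrict (parabolicCylinderCentered R z)), ‖u q.1 q.2‖ ≤ M)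
    (hGl : LocallyIntegrableOn (uncurry G) (parabolicCylinderCentered R z) volume)
    (j i k : Fin 3) :
    LocallyIntegrableOn (fun q => velC u j q * gradE G i k q) (parabolicCylinderCentered R z)
      volume := by
  have h := locallyIntegrableOn_inner_mul_inner_grad hu hbd hGl (𝐞 j) (𝐞 i) (𝐞 k)
  simpa using h

/-- **The weak-gradient identity in coordinates** (product-integral form):
`∫∫ φ Gᵢⱼ = -∫∫ (∂ⱼφ) uᵢ` for every space–time test function `φ` on the cylinder. [folklore] -/
theorem integral_test_mul_gradE
    (hG : HasWeakSpatialGradientOn (parabolicCylinderCenteredOpens R z) u G) {φ : ℝ → ℝ³ → ℝ}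
    (hφ : IsSpaceTimeTestOn (parabolicCylinderCenteredOpens R z) φ) (i j : Fin 3) :
    ∫ q : ℝ × ℝ³, φ q.1 q.2 * gradE G i j q =
      -∫ q : ℝ × ℝ³, fderiv ℝ (φ q.1) q.2 (𝐞 j) * velC u i q := by
  have h := hG.integral_fderiv_mul_inner_eq φ hφ (𝐞 j) (𝐞 i)
  simp only [inner_single_right_one] at h
  have hu : LocallyIntegrableOn (uncurry u) (parabolicCylinderCentered R z) volume :=
    hG.locallyIntegrableOn
  have IL : Integrable (fun q : ℝ × ℝ³ => fderiv ℝ (φ q.1) q.2 (𝐞 j) * velC u i q)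
      (volume : Measure (ℝ × ℝ³)) :=
    integrable_test_mul (locallyIntegrableOn_velC hu i) (isSpaceTimeTestOn_fderiv_apply hφ (𝐞 j))
  have IR : Integrable (fun q : ℝ × ℝ³ => φ q.1 q.2 * gradE G i j q) (volume : Measure (ℝ × ℝ³)) :=
    integrable_test_mul (locallyIntegrableOn_gradE hG.locallyIntegrableOn_grad i j) hφ
  have e1 : ∫ q : ℝ × ℝ³, fderiv ℝ (φ q.1) q.2 (𝐞 j) * velC u i q =
      ∫ t, ∫ x, fderiv ℝ (φ t) x (𝐞 j) * u t x i := by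
    have := IL
    rw [Measure.volume_eq_prod] at this ⊢
    exact integral_prod _ this
  have e2 : ∫ q : ℝ × ℝ³, φ q.1 q.2 * gradE G i j q = ∫ t, ∫ x, φ t x * G t x (𝐞 j) i := by
    have := IR
    rw [Measure.volume_eq_prod] at this ⊢
    exact integral_prod _ this
  rw [e1, e2, h, neg_neg]

/-- **The weak product rule in coordinates**:
`∫∫ (∂ₐθ) uᵢuₖ = -∫∫ θ (uᵢ G_{ka} + uₖ G_{ia})`. [folklore] -/
theorem integral_fderiv_mul_velC_mul_velC
    (hbd : ∀ᵐ q ∂(volume.restrict (parabolicCylinderCentered R z)), ‖u q.1 q.2‖ ≤ M)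
    (hG : HasWeakSpatialGradientOn (parabolicCylinderCenteredOpens R z) u G)
    (hG2 : ∫⁻ q in parabolicCylinderCentered R z, ENNReal.ofReal (frobeniusNormSq (G q.1 q.2)) < ⊤)
    {θ : ℝ → ℝ³ → ℝ} (hθ : IsSpaceTimeTestOn (parabolicCylinderCenteredOpens R z) θ)
    (a i k : Fin 3) :
    ∫ q : ℝ × ℝ³, fderiv ℝ (θ q.1) q.2 (𝐞 a) * (velC u i q * velC u k q) =
      -∫ q : ℝ × ℝ³, θ q.1 q.2 * (velC u i q * gradE G k a q + velC u k q * gradE G i a q) := by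
  have h := integral_fderiv_mul_inner_mul_inner hbd hG hG2 hθ (𝐞 a) (𝐞 i) (𝐞 k)
  simpa using h

/-- The trace term drops out: `∫∫ θ uᵢ tr G = 0`, since `tr G = 0` a.e. on the cylinder
(`SerrinBoundedHolder.ae_trace_eq_zero`) and `θ` vanishes off it. [folklore] -/
theorem integral_test_mul_velC_mul_trace
    (hsol : IsDistributionalNSSolutionOn (parabolicCylinderCenteredOpens R z) 1 0 u p)
    (hG : HasWeakSpatialGradientOn (parabolicCylinderCenteredOpens R z) u G)
    {θ : ℝ → ℝ³ → ℝ} (hθ : IsSpaceTimeTestOn (parabolicCylinderCenteredOpens R z) θ) (i : Fin 3) :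
    ∫ q : ℝ × ℝ³, θ q.1 q.2 * (velC u i q * ∑ j, gradE G j j q) = 0 := by
  refine integral_eq_zero_of_ae ?_
  filter_upwards [SerrinBoundedHolder.ae_trace_eq_zero hsol hG] with q hq
  by_cases hmem : q ∈ (parabolicCylinderCenteredOpens R z : Set (ℝ × ℝ³))
  · have := hq hmem
    simp only [gradE_apply, Pi.zero_apply]
    rw [this, mul_zero, mul_zero]
  · have h0 : θ q.1 q.2 = 0 := hθ.apply_eq_zero (by simpa using hmem)
    simp [h0]

/-- **The momentum equation against the divergence-free test field `Ψ = -(∂_cψ) e_b + (∂_bψ) e_c`**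
(the curl-type test field `ε`-contracted with `eᵢ`; Robinson–Rodrigo–Sadowski 2016, proof of
Thm. 12.1: "`curl φ` is divergence free and as a consequence can be used as a test function"). With
`∂ₜΨ + ΔΨ = -(∂_c(∂ₜψ + Δψ)) e_b + (∂_b(∂ₜψ + Δψ)) e_c` (Schwarz), `div Ψ = 0` (Schwarz) and
`⟪u, (u·∇)Ψ⟫ = -u_b Σⱼ uⱼ ∂ⱼ∂_cψ + u_c Σⱼ uⱼ ∂ⱼ∂_bψ`, the momentum equation reads
`-∫∫ ∂_c(∂ₜψ+Δψ) u_b + ∫∫ ∂_b(∂ₜψ+Δψ) u_c - ∫∫ Σⱼ (∂ⱼ∂_cψ) uⱼu_b + ∫∫ Σⱼ (∂ⱼ∂_bψ) uⱼu_c = 0`.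
[cite: RobinsonRodrigoSadowskiCUP2016, Thm. 12.1, proof, (12.5)] -/
theorem momentum_pairField
    (hsol : IsDistributionalNSSolutionOn (parabolicCylinderCenteredOpens R z) 1 0 u p)
    (hbd : ∀ᵐ q ∂(volume.restrict (parabolicCylinderCentered R z)), ‖u q.1 q.2‖ ≤ M)
    {ψ : ℝ → ℝ³ → ℝ} (hψ : IsSpaceTimeTestOn (parabolicCylinderCenteredOpens R z) ψ) (b c : Fin 3) :
    (-∫ q : ℝ × ℝ³, fderiv ℝ (heatTest ψ q.1) q.2 (𝐞 c) * velC u b q)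
      + (∫ q : ℝ × ℝ³, fderiv ℝ (heatTest ψ q.1) q.2 (𝐞 b) * velC u c q)
      - (∫ q : ℝ × ℝ³, ∑ j, fderiv ℝ (fun y => fderiv ℝ (ψ q.1) y (𝐞 c)) q.2 (𝐞 j) *
          (velC u j q * velC u b q))
      + (∫ q : ℝ × ℝ³, ∑ j, fderiv ℝ (fun y => fderiv ℝ (ψ q.1) y (𝐞 b)) q.2 (𝐞 j) *
          (velC u j q * velC u c q)) = 0 := by
  have hu : LocallyIntegrableOn (uncurry u) (parabolicCylinderCentered R z) volume := hsol.1
  have hmom := hsol.2.2.2.2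
  set Q : Opens (ℝ × ℝ³) := parabolicCylinderCenteredOpens R z with hQ
  -- the test fields
  set θ₁ : ℝ → ℝ³ → ℝ := fun t x => fderiv ℝ (ψ t) x (𝐞 c) with hθ₁
  set θ₂ : ℝ → ℝ³ → ℝ := fun t x => fderiv ℝ (ψ t) x (𝐞 b) with hθ₂
  have hθ₁t : IsSpaceTimeTestOn Q θ₁ := isSpaceTimeTestOn_fderiv_apply hψ (𝐞 c)
  have hθ₂t : IsSpaceTimeTestOn Q θ₂ := isSpaceTimeTestOn_fderiv_apply hψ (𝐞 b)
  have hχ : IsSpaceTimeTestOn Q (heatTest ψ) := isSpaceTimeTestOn_heatTest hψ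
  have hΨ : IsSpaceTimeTestOn Q (pairField θ₁ θ₂ (-(𝐞 b)) (𝐞 c)) :=
    isSpaceTimeTestOn_pairField hθ₁t hθ₂t _ _
  have hψ2 : ∀ t, ContDiff ℝ 2 (ψ t) := fun t => contDiff_infty.1 (hψ.contDiff_slice t) 2
  -- the momentum equation against `Ψ`, pointwise rewritten
  have key := hmom _ hΨ
  have hpt : ∀ q : ℝ × ℝ³,
      ⟪u q.1 q.2, timeDeriv (pairField θ₁ θ₂ (-(𝐞 b)) (𝐞 c)) q.1 q.2⟫ +
        ⟪u q.1 q.2, convect (u q.1) (pairField θ₁ θ₂ (-(𝐞 b)) (𝐞 c) q.1) q.2⟫ +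
        1 * ⟪u q.1 q.2, Δ (pairField θ₁ θ₂ (-(𝐞 b)) (𝐞 c) q.1) q.2⟫ +
        p q.1 q.2 * VectorCalculus.divergence (pairField θ₁ θ₂ (-(𝐞 b)) (𝐞 c) q.1) q.2 +
        ⟪(0 : ℝ → ℝ³ → ℝ³) q.1 q.2, pairField θ₁ θ₂ (-(𝐞 b)) (𝐞 c) q.1 q.2⟫ =
      -(fderiv ℝ (heatTest ψ q.1) q.2 (𝐞 c) * velC u b q) +
        fderiv ℝ (heatTest ψ q.1) q.2 (𝐞 b) * velC u c q -
        (∑ j, fderiv ℝ (θ₁ q.1) q.2 (𝐞 j) * (velC u j q * velC u b q)) +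
        ∑ j, fderiv ℝ (θ₂ q.1) q.2 (𝐞 j) * (velC u j q * velC u c q) := by
    rintro ⟨t, x⟩
    have e1 := timeDeriv_pairField (v₁ := -(𝐞 b)) (v₂ := (𝐞 c)) hθ₁t hθ₂t t x
    have e2 := convect_pairField (v₁ := -(𝐞 b)) (v₂ := (𝐞 c)) hθ₁t hθ₂t (u t) t x
    have e3 := laplacian_pairField (v₁ := -(𝐞 b)) (v₂ := (𝐞 c)) hθ₁t hθ₂t t x
    have e4 := divergence_pairField (v₁ := -(𝐞 b)) (v₂ := (𝐞 c)) hθ₁t hθ₂t t x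
    -- Schwarz: the divergence vanishes
    have hS : fderiv ℝ (θ₁ t) x (𝐞 b) = fderiv ℝ (θ₂ t) x (𝐞 c) :=
      SerrinBoundedHolder.fderiv_fderiv_apply_comm (hψ2 t) x (𝐞 c) (𝐞 b)
    -- `∂ₜ∂ψ + Δ∂ψ = ∂(∂ₜψ + Δψ)`
    have hT1 : fderiv ℝ (heatTest ψ t) x (𝐞 c) = timeDeriv θ₁ t x + Δ (θ₁ t) x :=
      fderiv_timeDeriv_add_laplacian hψ (𝐞 c) t x
    have hT2 : fderiv ℝ (heatTest ψ t) x (𝐞 b) = timeDeriv θ₂ t x + Δ (θ₂ t) x :=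
      fderiv_timeDeriv_add_laplacian hψ (𝐞 b) t x
    -- the convective terms in coordinates
    have hC1 : fderiv ℝ (θ₁ t) x (u t x) = ∑ j, u t x j * fderiv ℝ (θ₁ t) x (𝐞 j) :=
      clm_apply_eq_sum _ _
    have hC2 : fderiv ℝ (θ₂ t) x (u t x) = ∑ j, u t x j * fderiv ℝ (θ₂ t) x (𝐞 j) :=
      clm_apply_eq_sum _ _
    have hC1' : fderiv ℝ (θ₁ t) x (u t x) * u t x b =
        ∑ j, fderiv ℝ (θ₁ t) x (𝐞 j) * (u t x j * u t x b) := by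
      rw [hC1, Finset.sum_mul]
      exact Finset.sum_congr rfl fun j _ => by ring
    have hC2' : fderiv ℝ (θ₂ t) x (u t x) * u t x c =
        ∑ j, fderiv ℝ (θ₂ t) x (𝐞 j) * (u t x j * u t x c) := by
      rw [hC2, Finset.sum_mul]
      exact Finset.sum_congr rfl fun j _ => by ring
    rw [e1, e2, e3, e4]
    simp only [inner_add_right, inner_smul_right, inner_neg_right, inner_single_right_one, map_neg,
      Pi.zero_apply, inner_zero_left, velC_apply, hS, hT1, hT2]
    linear_combination (-1 : ℝ) * hC1' + hC2'
  -- the rewritten integrand, as a function on space–time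
  set T : ℝ × ℝ³ → ℝ := fun q =>
      -(fderiv ℝ (heatTest ψ q.1) q.2 (𝐞 c) * velC u b q) +
        fderiv ℝ (heatTest ψ q.1) q.2 (𝐞 b) * velC u c q -
        (∑ j, fderiv ℝ (θ₁ q.1) q.2 (𝐞 j) * (velC u j q * velC u b q)) +
        ∑ j, fderiv ℝ (θ₂ q.1) q.2 (𝐞 j) * (velC u j q * velC u c q) with hT
  have key' : ∫ q in (Q : Set (ℝ × ℝ³)), T q = 0 := by
    rw [← key]
    exact setIntegral_congr_fun Q.isOpen.measurableSet fun q _ => (hpt q).symm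
  -- `T` vanishes off `Q`
  have hdχc := isSpaceTimeTestOn_fderiv_apply hχ (𝐞 c)
  have hdχb := isSpaceTimeTestOn_fderiv_apply hχ (𝐞 b)
  have hdθ₁ := fun j : Fin 3 => isSpaceTimeTestOn_fderiv_apply hθ₁t (𝐞 j)
  have hdθ₂ := fun j : Fin 3 => isSpaceTimeTestOn_fderiv_apply hθ₂t (𝐞 j)
  have hT0 : ∀ q, q ∉ (Q : Set (ℝ × ℝ³)) → T q = 0 := by
    intro q hq
    have hq' : (q.1, q.2) ∉ (Q : Set (ℝ × ℝ³)) := by simpa using hq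
    have z1 : fderiv ℝ (heatTest ψ q.1) q.2 (𝐞 c) = 0 := hdχc.apply_eq_zero hq'
    have z2 : fderiv ℝ (heatTest ψ q.1) q.2 (𝐞 b) = 0 := hdχb.apply_eq_zero hq'
    have z3 : ∀ j, fderiv ℝ (θ₁ q.1) q.2 (𝐞 j) = 0 := fun j => (hdθ₁ j).apply_eq_zero hq'
    have z4 : ∀ j, fderiv ℝ (θ₂ q.1) q.2 (𝐞 j) = 0 := fun j => (hdθ₂ j).apply_eq_zero hq'
    simp [hT, z1, z2, z3, z4]
  have hwhole : ∫ q, T q = 0 := by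
    rw [← setIntegral_eq_integral_of_forall_compl_eq_zero hT0]
    exact key'
  -- split the integral
  have I1 : Integrable (fun q : ℝ × ℝ³ => fderiv ℝ (heatTest ψ q.1) q.2 (𝐞 c) * velC u b q)
      (volume : Measure (ℝ × ℝ³)) := integrable_test_mul (locallyIntegrableOn_velC hu b) hdχc
  have I2 : Integrable (fun q : ℝ × ℝ³ => fderiv ℝ (heatTest ψ q.1) q.2 (𝐞 b) * velC u c q)
      (volume : Measure (ℝ × ℝ³)) := integrable_test_mul (locallyIntegrableOn_velC hu c) hdχb
  have I3 : Integrable (fun q : ℝ × ℝ³ =>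
      ∑ j, fderiv ℝ (θ₁ q.1) q.2 (𝐞 j) * (velC u j q * velC u b q)) (volume : Measure (ℝ × ℝ³)) :=
    integrable_finsetSum _ fun j _ =>
      integrable_test_mul (locallyIntegrableOn_velC_mul_velC hu hbd j b) (hdθ₁ j)
  have I4 : Integrable (fun q : ℝ × ℝ³ =>
      ∑ j, fderiv ℝ (θ₂ q.1) q.2 (𝐞 j) * (velC u j q * velC u c q)) (volume : Measure (ℝ × ℝ³)) :=
    integrable_finsetSum _ fun j _ =>
      integrable_test_mul (locallyIntegrableOn_velC_mul_velC hu hbd j c) (hdθ₂ j)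
  have I12 : Integrable (fun q : ℝ × ℝ³ => -(fderiv ℝ (heatTest ψ q.1) q.2 (𝐞 c) * velC u b q) +
      fderiv ℝ (heatTest ψ q.1) q.2 (𝐞 b) * velC u c q) (volume : Measure (ℝ × ℝ³)) :=
    I1.neg.add I2
  have I123 : Integrable (fun q : ℝ × ℝ³ => -(fderiv ℝ (heatTest ψ q.1) q.2 (𝐞 c) * velC u b q) +
      fderiv ℝ (heatTest ψ q.1) q.2 (𝐞 b) * velC u c q -
      ∑ j, fderiv ℝ (θ₁ q.1) q.2 (𝐞 j) * (velC u j q * velC u b q)) (volume : Measure (ℝ × ℝ³)) :=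
    I12.sub I3
  have I1n : Integrable (fun q : ℝ × ℝ³ => -(fderiv ℝ (heatTest ψ q.1) q.2 (𝐞 c) * velC u b q))
      (volume : Measure (ℝ × ℝ³)) := I1.neg
  have hsplit : ∫ q, T q = (-∫ q : ℝ × ℝ³, fderiv ℝ (heatTest ψ q.1) q.2 (𝐞 c) * velC u b q)
      + (∫ q : ℝ × ℝ³, fderiv ℝ (heatTest ψ q.1) q.2 (𝐞 b) * velC u c q)
      - (∫ q : ℝ × ℝ³, ∑ j, fderiv ℝ (θ₁ q.1) q.2 (𝐞 j) * (velC u j q * velC u b q))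
      + (∫ q : ℝ × ℝ³, ∑ j, fderiv ℝ (θ₂ q.1) q.2 (𝐞 j) * (velC u j q * velC u c q)) := by
    simp only [hT]
    rw [integral_add I123 I4, integral_sub I12 I3, integral_add I1n I2, integral_neg]
  rw [hsplit] at hwhole
  exact hwhole

/-- **The weak vorticity equation in coordinates.** Under the hypotheses of
`NSSpinHeatEquation` (distributional Navier–Stokes solution on `Q*_R(z)`, `|u| ≤ M`, weak spatial
gradient `G ∈ L²`), for all `b, c` and every `ψ ∈ C_c^∞(Q*_R(z))`,
`∫∫ (G_{bc} - G_{cb})(∂ₜψ + Δψ) = -∫∫ (∂_cψ) Σⱼ uⱼ(G_{bj} - G_{jb}) + ∫∫ (∂_bψ) Σⱼ uⱼ(G_{cj} - G_{jc})`.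
Proof (Robinson–Rodrigo–Sadowski 2016, proof of Thm. 12.1, pp. 167–168, antisymmetrised): the
weak-gradient identity against `χ = ∂ₜψ + Δψ` turns the left side into
`-∫∫ (∂_cχ) u_b + ∫∫ (∂_bχ) u_c`; the momentum equation against `-(∂_cψ) e_b + (∂_bψ) e_c`
(`momentum_pairField`) equates this with `∫∫ Σⱼ (∂ⱼ∂_cψ) uⱼu_b - ∫∫ Σⱼ (∂ⱼ∂_bψ) uⱼu_c`; the weak
product rule (`integral_fderiv_mul_velC_mul_velC`) and `tr G = 0` give
`-∫∫ (∂_cψ) Σⱼ uⱼG_{bj} + ∫∫ (∂_bψ) Σⱼ uⱼG_{cj}`; finally `G_{bj} = A_{bj} + G_{jb}` and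
`Σⱼ uⱼG_{jb} = ½∂_b|u|²` weakly, whose contributions cancel by Schwarz (`∂_b∂_cψ = ∂_c∂_bψ`).
[cite: RobinsonRodrigoSadowskiCUP2016, Thm. 12.1 with (12.4) and its proof] -/
theorem integral_spin_mul_heatTest
    (hsol : IsDistributionalNSSolutionOn (parabolicCylinderCenteredOpens R z) 1 0 u p)
    (hbd : ∀ᵐ q ∂(volume.restrict (parabolicCylinderCentered R z)), ‖u q.1 q.2‖ ≤ M)
    (hG : HasWeakSpatialGradientOn (parabolicCylinderCenteredOpens R z) u G)
    (hG2 : ∫⁻ q in parabolicCylinderCentered R z, ENNReal.ofReal (frobeniusNormSq (G q.1 q.2)) < ⊤)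
    (b c : Fin 3) {ψ : ℝ → ℝ³ → ℝ} (hψ : IsSpaceTimeTestOn (parabolicCylinderCenteredOpens R z) ψ) :
    ∫ q : ℝ × ℝ³, (gradE G b c q - gradE G c b q) * heatTest ψ q.1 q.2 =
      -(∫ q : ℝ × ℝ³, fderiv ℝ (ψ q.1) q.2 (𝐞 c) * ∑ j, velC u j q * (gradE G b j q - gradE G j b q))
      + ∫ q : ℝ × ℝ³, fderiv ℝ (ψ q.1) q.2 (𝐞 b) * ∑ j, velC u j q * (gradE G c j q - gradE G j c q) := by
  have hu : LocallyIntegrableOn (uncurry u) (parabolicCylinderCentered R z) volume := hsol.1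
  have hGl : LocallyIntegrableOn (uncurry G) (parabolicCylinderCentered R z) volume :=
    hG.locallyIntegrableOn_grad
  set Q : Opens (ℝ × ℝ³) := parabolicCylinderCenteredOpens R z with hQ
  set θ₁ : ℝ → ℝ³ → ℝ := fun t x => fderiv ℝ (ψ t) x (𝐞 c) with hθ₁
  set θ₂ : ℝ → ℝ³ → ℝ := fun t x => fderiv ℝ (ψ t) x (𝐞 b) with hθ₂
  have hθ₁t : IsSpaceTimeTestOn Q θ₁ := isSpaceTimeTestOn_fderiv_apply hψ (𝐞 c)
  have hθ₂t : IsSpaceTimeTestOn Q θ₂ := isSpaceTimeTestOn_fderiv_apply hψ (𝐞 b)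
  have hχ : IsSpaceTimeTestOn Q (heatTest ψ) := isSpaceTimeTestOn_heatTest hψ
  have hψ2 : ∀ t, ContDiff ℝ 2 (ψ t) := fun t => contDiff_infty.1 (hψ.contDiff_slice t) 2
  -- integrability facts
  have Iχ : ∀ i j, Integrable (fun q : ℝ × ℝ³ => heatTest ψ q.1 q.2 * gradE G i j q)
      (volume : Measure (ℝ × ℝ³)) := fun i j =>
    integrable_test_mul (locallyIntegrableOn_gradE hGl i j) hχ
  have Iθ : ∀ {θ : ℝ → ℝ³ → ℝ}, IsSpaceTimeTestOn Q θ → ∀ j i k,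
      Integrable (fun q : ℝ × ℝ³ => θ q.1 q.2 * (velC u j q * gradE G i k q))
        (volume : Measure (ℝ × ℝ³)) :=
    fun hθ j i k => integrable_test_mul (locallyIntegrableOn_velC_mul_gradE hu hbd hGl j i k) hθ
  have IA : ∀ {θ : ℝ → ℝ³ → ℝ}, IsSpaceTimeTestOn Q θ → ∀ j i,
      Integrable (fun q : ℝ × ℝ³ => θ q.1 q.2 * (velC u j q * (gradE G i j q - gradE G j i q)))
        (volume : Measure (ℝ × ℝ³)) := by
    intro θ hθ j i
    refine ((Iθ hθ j i j).sub (Iθ hθ j j i)).congr (Eventually.of_forall fun q => ?_)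
    simp only [Pi.sub_apply]
    ring
  -- Step 1: the weak-gradient identity against `χ = ∂ₜψ + Δψ`
  have s1 := integral_test_mul_gradE hG hχ b c
  have s2 := integral_test_mul_gradE hG hχ c b
  have lhs : ∫ q : ℝ × ℝ³, (gradE G b c q - gradE G c b q) * heatTest ψ q.1 q.2 =
      (∫ q : ℝ × ℝ³, heatTest ψ q.1 q.2 * gradE G b c q) -
        ∫ q : ℝ × ℝ³, heatTest ψ q.1 q.2 * gradE G c b q := by
    rw [← integral_sub (Iχ b c) (Iχ c b)]
    refine integral_congr_ae (Eventually.of_forall fun q => ?_)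
    simp only
    ring
  -- Step 2: the momentum equation against `-(∂_cψ) e_b + (∂_bψ) e_c`
  have m : (-∫ q : ℝ × ℝ³, fderiv ℝ (heatTest ψ q.1) q.2 (𝐞 c) * velC u b q)
      + (∫ q : ℝ × ℝ³, fderiv ℝ (heatTest ψ q.1) q.2 (𝐞 b) * velC u c q)
      - (∫ q : ℝ × ℝ³, ∑ j, fderiv ℝ (θ₁ q.1) q.2 (𝐞 j) * (velC u j q * velC u b q))
      + (∫ q : ℝ × ℝ³, ∑ j, fderiv ℝ (θ₂ q.1) q.2 (𝐞 j) * (velC u j q * velC u c q)) = 0 :=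
    momentum_pairField hsol hbd hψ b c
  -- Step 3: the product rule and the trace
  have pr1 : ∀ j, ∫ q : ℝ × ℝ³, fderiv ℝ (θ₁ q.1) q.2 (𝐞 j) * (velC u j q * velC u b q) =
      -∫ q : ℝ × ℝ³, θ₁ q.1 q.2 * (velC u j q * gradE G b j q + velC u b q * gradE G j j q) :=
    fun j => integral_fderiv_mul_velC_mul_velC hbd hG hG2 hθ₁t j j b
  have pr2 : ∀ j, ∫ q : ℝ × ℝ³, fderiv ℝ (θ₂ q.1) q.2 (𝐞 j) * (velC u j q * velC u c q) =
      -∫ q : ℝ × ℝ³, θ₂ q.1 q.2 * (velC u j q * gradE G c j q + velC u c q * gradE G j j q) :=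
    fun j => integral_fderiv_mul_velC_mul_velC hbd hG hG2 hθ₂t j j c
  have tr1 := integral_test_mul_velC_mul_trace hsol hG hθ₁t b
  have tr2 := integral_test_mul_velC_mul_trace hsol hG hθ₂t c
  have conv : ∀ {θ : ℝ → ℝ³ → ℝ} (hθ : IsSpaceTimeTestOn Q θ) (i : Fin 3),
      (∀ j, ∫ q : ℝ × ℝ³, fderiv ℝ (θ q.1) q.2 (𝐞 j) * (velC u j q * velC u i q) =
        -∫ q : ℝ × ℝ³, θ q.1 q.2 * (velC u j q * gradE G i j q + velC u i q * gradE G j j q)) →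
      ∫ q : ℝ × ℝ³, θ q.1 q.2 * (velC u i q * ∑ j, gradE G j j q) = 0 →
      ∫ q : ℝ × ℝ³, ∑ j, fderiv ℝ (θ q.1) q.2 (𝐞 j) * (velC u j q * velC u i q) =
        -∑ j, ∫ q : ℝ × ℝ³, θ q.1 q.2 * (velC u j q * gradE G i j q) := by
    intro θ hθ i hpr htr
    have hdθ := fun j : Fin 3 => isSpaceTimeTestOn_fderiv_apply hθ (𝐞 j)
    rw [integral_finsetSum _ fun j _ =>
      integrable_test_mul (locallyIntegrableOn_velC_mul_velC hu hbd j i) (hdθ j)]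
    have hY : ∑ j, ∫ q : ℝ × ℝ³, θ q.1 q.2 * (velC u i q * gradE G j j q) = 0 := by
      rw [← integral_finsetSum _ fun j _ => Iθ hθ i j j, ← htr]
      refine integral_congr_ae (Eventually.of_forall fun q => ?_)
      simp only [Finset.mul_sum]
    have each : ∀ j, ∫ q : ℝ × ℝ³, fderiv ℝ (θ q.1) q.2 (𝐞 j) * (velC u j q * velC u i q) =
        -(∫ q : ℝ × ℝ³, θ q.1 q.2 * (velC u j q * gradE G i j q)) -
          ∫ q : ℝ × ℝ³, θ q.1 q.2 * (velC u i q * gradE G j j q) := by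
      intro j
      have hadd : ∫ q : ℝ × ℝ³, θ q.1 q.2 * (velC u j q * gradE G i j q + velC u i q * gradE G j j q) =
          (∫ q : ℝ × ℝ³, θ q.1 q.2 * (velC u j q * gradE G i j q)) +
            ∫ q : ℝ × ℝ³, θ q.1 q.2 * (velC u i q * gradE G j j q) := by
        rw [← integral_add (Iθ hθ j i j) (Iθ hθ i j j)]
        refine integral_congr_ae (Eventually.of_forall fun q => ?_)
        simp only
        ring
      rw [hpr j, hadd]
      ring
    calc ∑ j, ∫ q : ℝ × ℝ³, fderiv ℝ (θ q.1) q.2 (𝐞 j) * (velC u j q * velC u i q)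
        = ∑ j, (-(∫ q : ℝ × ℝ³, θ q.1 q.2 * (velC u j q * gradE G i j q)) -
            ∫ q : ℝ × ℝ³, θ q.1 q.2 * (velC u i q * gradE G j j q)) :=
          Finset.sum_congr rfl fun j _ => each j
      _ = -∑ j, (∫ q : ℝ × ℝ³, θ q.1 q.2 * (velC u j q * gradE G i j q)) -
            ∑ j, ∫ q : ℝ × ℝ³, θ q.1 q.2 * (velC u i q * gradE G j j q) := by
          rw [Finset.sum_sub_distrib, Finset.sum_neg_distrib]
      _ = -∑ j, ∫ q : ℝ × ℝ³, θ q.1 q.2 * (velC u j q * gradE G i j q) := by rw [hY, sub_zero]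
  have P3 := conv hθ₁t b pr1 tr1
  have P4 := conv hθ₂t c pr2 tr2
  -- Step 4: `G_{ij} = A_{ij} + G_{ji}`; the symmetric part is `½ ∂|u|²` weakly and cancels
  have dsum : ∀ {θ : ℝ → ℝ³ → ℝ} (hθ : IsSpaceTimeTestOn Q θ) (i : Fin 3),
      ∑ j, ∫ q : ℝ × ℝ³, θ q.1 q.2 * (velC u j q * gradE G i j q) =
        (∑ j, ∫ q : ℝ × ℝ³, θ q.1 q.2 * (velC u j q * (gradE G i j q - gradE G j i q))) +
          ∑ j, ∫ q : ℝ × ℝ³, θ q.1 q.2 * (velC u j q * gradE G j i q) := by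
    intro θ hθ i
    rw [← Finset.sum_add_distrib]
    refine Finset.sum_congr rfl fun j _ => ?_
    rw [← integral_add (IA hθ j i) (Iθ hθ j j i)]
    refine integral_congr_ae (Eventually.of_forall fun q => ?_)
    simp only
    ring
  have dsym : ∀ {θ : ℝ → ℝ³ → ℝ} (hθ : IsSpaceTimeTestOn Q θ) (i : Fin 3),
      ∑ j, ∫ q : ℝ × ℝ³, θ q.1 q.2 * (velC u j q * gradE G j i q) =
        -(1 / 2) * ∑ j, ∫ q : ℝ × ℝ³, fderiv ℝ (θ q.1) q.2 (𝐞 i) * (velC u j q * velC u j q) := by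
    intro θ hθ i
    rw [Finset.mul_sum]
    refine Finset.sum_congr rfl fun j _ => ?_
    have h := integral_fderiv_mul_velC_mul_velC hbd hG hG2 hθ i j j
    have h2 : ∫ q : ℝ × ℝ³, θ q.1 q.2 * (velC u j q * gradE G j i q + velC u j q * gradE G j i q) =
        2 * ∫ q : ℝ × ℝ³, θ q.1 q.2 * (velC u j q * gradE G j i q) := by
      rw [← integral_const_mul]
      refine integral_congr_ae (Eventually.of_forall fun q => ?_)
      ring
    rw [h2] at h
    linarith
  have dsch : ∑ j, ∫ q : ℝ × ℝ³, fderiv ℝ (θ₁ q.1) q.2 (𝐞 b) * (velC u j q * velC u j q) =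
      ∑ j, ∫ q : ℝ × ℝ³, fderiv ℝ (θ₂ q.1) q.2 (𝐞 c) * (velC u j q * velC u j q) := by
    refine Finset.sum_congr rfl fun j _ => ?_
    refine integral_congr_ae (Eventually.of_forall fun q => ?_)
    have hS : fderiv ℝ (θ₁ q.1) q.2 (𝐞 b) = fderiv ℝ (θ₂ q.1) q.2 (𝐞 c) :=
      SerrinBoundedHolder.fderiv_fderiv_apply_comm (hψ2 q.1) q.2 (𝐞 c) (𝐞 b)
    simp only [hS]
  have dsum1 := dsum hθ₁t b
  have dsum2 := dsum hθ₂t c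
  have dsym1 := dsym hθ₁t b
  have dsym2 := dsym hθ₂t c
  -- the right-hand side sums
  have rhs1 : ∫ q : ℝ × ℝ³, fderiv ℝ (ψ q.1) q.2 (𝐞 c) *
      ∑ j, velC u j q * (gradE G b j q - gradE G j b q) =
      ∑ j, ∫ q : ℝ × ℝ³, θ₁ q.1 q.2 * (velC u j q * (gradE G b j q - gradE G j b q)) := by
    rw [← integral_finsetSum _ fun j _ => IA hθ₁t j b]
    refine integral_congr_ae (Eventually.of_forall fun q => ?_)
    simp only [Finset.mul_sum]
    rfl
  have rhs2 : ∫ q : ℝ × ℝ³, fderiv ℝ (ψ q.1) q.2 (𝐞 b) *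
      ∑ j, velC u j q * (gradE G c j q - gradE G j c q) =
      ∑ j, ∫ q : ℝ × ℝ³, θ₂ q.1 q.2 * (velC u j q * (gradE G c j q - gradE G j c q)) := by
    rw [← integral_finsetSum _ fun j _ => IA hθ₂t j c]
    refine integral_congr_ae (Eventually.of_forall fun q => ?_)
    simp only [Finset.mul_sum]
    rfl
  rw [lhs, s1, s2, rhs1, rhs2]
  linarith [m, P3, P4, dsum1, dsum2, dsym1, dsym2, dsch]

/-- Integrability of a test function times the flux sums `Σⱼ uⱼ (G_{ij} - G_{ji})`. [folklore] -/
theorem integrable_test_mul_fluxSum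
    (hu : LocallyIntegrableOn (uncurry u) (parabolicCylinderCentered R z) volume)
    (hbd : ∀ᵐ q ∂(volume.restrict (parabolicCylinderCentered R z)), ‖u q.1 q.2‖ ≤ M)
    (hGl : LocallyIntegrableOn (uncurry G) (parabolicCylinderCentered R z) volume)
    {θ : ℝ → ℝ³ → ℝ} (hθ : IsSpaceTimeTestOn (parabolicCylinderCenteredOpens R z) θ) (i : Fin 3) :
    Integrable (fun q : ℝ × ℝ³ => θ q.1 q.2 * ∑ j, velC u j q * (gradE G i j q - gradE G j i q))
      (volume : Measure (ℝ × ℝ³)) := by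
  have Iθ : ∀ j i k, Integrable (fun q : ℝ × ℝ³ => θ q.1 q.2 * (velC u j q * gradE G i k q))
      (volume : Measure (ℝ × ℝ³)) :=
    fun j i k => integrable_test_mul (locallyIntegrableOn_velC_mul_gradE hu hbd hGl j i k) hθ
  have IA : ∀ j, Integrable (fun q : ℝ × ℝ³ => θ q.1 q.2 * (velC u j q * (gradE G i j q - gradE G j i q)))
      (volume : Measure (ℝ × ℝ³)) := by
    intro j
    refine ((Iθ j i j).sub (Iθ j j i)).congr (Eventually.of_forall fun q => ?_)
    simp only [Pi.sub_apply]
    ring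
  refine (integrable_finsetSum Finset.univ fun j _ => IA j).congr (Eventually.of_forall fun q => ?_)
  simp only [Finset.mul_sum]

end NSSpinHeat

/-! ### The discharge of `NSSpinHeatEquation` -/

section Discharge

open NSSpinHeat

/-- Local notation for physical space `ℝ³ = EuclideanSpace ℝ (Fin 3)`. -/
local notation "ℝ³" => EuclideanSpace ℝ (Fin 3)

/-- Local notation for the standard basis vectors of `ℝ³`. -/
local notation "𝐞" j => EuclideanSpace.single (j : Fin 3) (1 : ℝ)

/-- **Discharge of the named fact `NSSpinHeatEquation`** (Robinson–Rodrigo–Sadowski 2016,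
Thm. 12.1 with (12.4), local form of §13.3.2 Step 1): the weak vorticity equation
`∫∫ A_{bc}(∂ₜψ + Δψ) = ∫∫ ⟪spinFlux u G b c, ∇ψ⟫` for the entries `A_{bc} = G_{bc} - G_{cb}` of
`∇u - (∇u)ᵀ` of a bounded distributional Navier–Stokes solution with `∇u ∈ L²` on `Q*_R(z)`
(`NSSpinHeat.integral_spin_mul_heatTest` with `⟪spinFlux, ∇ψ⟫ = -(∂_cψ) ΣⱼuⱼA_{bj} + (∂_bψ) ΣⱼuⱼA_{cj}`).
[cite: RobinsonRodrigoSadowskiCUP2016, Thm. 12.1 with (12.4); local form of §13.3.2 Step 1, (13.11)–(13.12)] -/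
theorem NSSpinHeatEquation_holds : NSSpinHeatEquation := by
  intro u p z R M G hsol hbd hG hG2 b c ψ hψ
  have hu : LocallyIntegrableOn (uncurry u) (parabolicCylinderCentered R z) volume := hsol.1
  have hGl : LocallyIntegrableOn (uncurry G) (parabolicCylinderCentered R z) volume :=
    hG.locallyIntegrableOn_grad
  have h := integral_spin_mul_heatTest hsol hbd hG hG2 b c hψ
  have eL : (fun q : ℝ × ℝ³ => spinEntry G b c q * (timeDeriv ψ q.1 q.2 + Δ (ψ q.1) q.2)) =
      fun q => (gradE G b c q - gradE G c b q) * heatTest ψ q.1 q.2 := rfl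
  have eR : ∀ q : ℝ × ℝ³, ⟪spinFlux u G b c q, gradient (ψ q.1) q.2⟫ =
      -(fderiv ℝ (ψ q.1) q.2 (𝐞 c) * ∑ j, velC u j q * (gradE G b j q - gradE G j b q)) +
        fderiv ℝ (ψ q.1) q.2 (𝐞 b) * ∑ j, velC u j q * (gradE G c j q - gradE G j c q) := by
    intro q
    simp only [spinFlux, spinEntry, inner_add_left, real_inner_smul_left, inner_single_left_one,
      SerrinBoundedHolder.gradient_coord, velC_apply, gradE_apply]
    ring
  have I1 : Integrable (fun q : ℝ × ℝ³ =>
      fderiv ℝ (ψ q.1) q.2 (𝐞 c) * ∑ j, velC u j q * (gradE G b j q - gradE G j b q))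
      (volume : Measure (ℝ × ℝ³)) :=
    integrable_test_mul_fluxSum hu hbd hGl (isSpaceTimeTestOn_fderiv_apply hψ (𝐞 c)) b
  have I2 : Integrable (fun q : ℝ × ℝ³ =>
      fderiv ℝ (ψ q.1) q.2 (𝐞 b) * ∑ j, velC u j q * (gradE G c j q - gradE G j c q))
      (volume : Measure (ℝ × ℝ³)) :=
    integrable_test_mul_fluxSum hu hbd hGl (isSpaceTimeTestOn_fderiv_apply hψ (𝐞 b)) c
  have I1n : Integrable (fun q : ℝ × ℝ³ =>
      -(fderiv ℝ (ψ q.1) q.2 (𝐞 c) * ∑ j, velC u j q * (gradE G b j q - gradE G j b q)))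
      (volume : Measure (ℝ × ℝ³)) := I1.neg
  rw [eL, h, integral_congr_ae (Eventually.of_forall eR), integral_add I1n I2, integral_neg]

end Discharge

end Literature.Analysis.FluidPDE
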